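import Mathlib
import Literature.NumberTheory.DiophantineGeometry.ValuationProductElliptic
import HarnessLib

/-!
# Pasten, *Shimura curves and the abc conjecture*, Theorem 16.5 (second part): the printed reduction

Sibling proof file of `ValuationProductElliptic.lean` for the named fact
`Literature.NumberTheory.DiophantineGeometry.pastenShimura2024_thm_16_5_manyPrimes` (H. Pasten,
J. Number Theory 254 (2024) = arXiv:1705.09251, §16.3, "Theorem 16.5" of the arXiv text, second
display: for semi-stable `E/ℚ` with at least `3 + 11/ε` places of bad reduction,
`∏_{p ∣ N_E} v_p(Δ_E) < K_ε · N_E^{8/3+ε}`).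

## What is proved here, and what is not

The printed proof (arXiv p. 50) is a short reduction to **Theorem 16.4 (i)** (loc. cit.): "Let
`ε > 0`. Let `E/ℚ` be an elliptic curve of conductor `N ≫_ε 1`. Let `N = DM` be an admissible
factorisation and suppose that `E` is semi-stable and `M` is not a prime number. Then
`∏_{p ∣ D} v_p(Δ) < N^{8/3+ε} M`" (admissible, p. 12: `D`, `M` coprime, `D` a product of an even
number of distinct primes; for squarefree `N`: `D ∣ N` with an even number of prime factors,
`M = N/D`).  Theorem 16.4 rests on the whole Shimura-curve apparatus of the paper (refined
Ribet–Takahashi formula, Jacquet–Langlands optimal quotients, Frey's modular-degree formula, the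
Arakelov bound Thm 14.1 for integral quaternionic forms, Mai–Murty, Mazur–Kenku, Manin constant,
modularity), none of which is in Mathlib; it is NOT vendored as a named fact (D-0026) and enters
only as the explicit hypothesis `h164` below.  Formalised: `prod_lt_rpow_of_forall_triple`, the
"`(n-3)`-rd root" step for `n = ω(N)` odd (Theorem 16.4 (i) for `M =` three of the primes, `D = N/M`,
over all `C(n,3)` triples — the print uses the `n` cyclically consecutive ones; same double count, no
ordering of the primes needed); `prod_lt_rpow_of_thm_16_4_at`, one curve of large conductor (`n`
even: `D = N`, `M = 1`; `n` odd: the previous step); `pastenShimura2024_thm_16_5_manyPrimes_strict_of_thm_16_4`,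
the theorem for all semi-stable `E/ℚ` with MORE THAN `3 + 11/ε` bad places, from `h164` and the
parent file's named fact `pastenShimura2024_thm_1_12` (Theorem 1.12 = Theorem 16.5, first part) —
declared deviation: the print discards the finitely many curves of conductor `< N_0(ε')` by
Shafarevich's theorem (p. 12), here they are absorbed into `K` through Theorem 1.12 with exponent
`11/2 + 1` (the assembly with the absorbing bound as a parameter is
`pastenShimura2024_thm_16_5_manyPrimes_strict_of_bound_of_thm_16_4`; fed instead by the parent file's
named fact `pastenShimura2024_cor_16_2` — Corollary 16.2 at `S = ∅`, so that, as in §16 itself, neither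
Theorem 1.12 nor Mestre–Oesterlé enters — it gives
`pastenShimura2024_thm_16_5_manyPrimes_strict_of_cor_16_2_of_thm_16_4`);
`pastenShimura2024_thm_16_5_manyPrimes_of_strict`, hence the vendored "at least" form for every `ε > 0`
with `11/ε ∉ ℕ`.

## Caveat on the boundary (why "more than" and not "at least")

The printed proof needs `(8/3+ε')·n/(n-3) + 3/(n-3) < 8/3 + ε`, i.e. `11/(n-3) < ε`, i.e.
`n > 3 + 11/ε` ("for all integers `n > 11/ε + 3`", loc. cit.), while the statement says "at least".
When `11/ε = m ∈ ℕ` the boundary `n = m + 3` is still covered by the paper's arguments for `n` even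
(`D = N`), `n = 5` (Theorem 1.12: `8/3 + 11/2 > 11/2`) and `n = 7, 9, 11` (Theorem 16.1 with
`D = N/p_i` as in the proof of Corollary 16.2: `(11/3)·n/(n-1) < 8/3 + 11/(n-3)` iff `n ≤ 11`), but
for `ε = 11/m`, `m` even `≥ 10`, curves with exactly `m + 3` bad primes are not covered by the printed
arguments (nor by weighted combinations of the bounds of Theorems 16.1 / 16.4 (i) over admissible
factorisations when the bad primes have comparable size).  Formally,
`pastenShimura2024_thm_16_5_manyPrimes_of_thm_1_12_of_thm_16_1_of_thm_16_4` (last section) gives the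
vendored "at least" form at every `ε > 0` OFF the set `{11/m : m even, m ≥ 10}` from Theorem 1.12 (named
fact), Theorem 16.1 (semi-stable case, `S = ∅`, inline hypothesis) and Theorem 16.4 (i) (inline
hypothesis), through `prod_lt_rpow_of_forall_erase` / `prod_lt_rpow_of_thm_16_1_at` (the
`(n-1)`-st-root device of the proof of Corollary 16.2) and `prod_lt_rpow_of_thm_16_4_at_even`.  The named
fact stays vendored as printed (`≤`); this file records what the printed proofs establish; no statement
of the parent file changes.

## References

* [PastenShimura2024] H. Pasten, *Shimura curves and the abc conjecture*, J. Number Theory 254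
  (2024), 214–335, doi:10.1016/j.jnt.2023.07.002, arXiv:1705.09251 — p. 12 (admissible
  factorisations, Shafarevich reduction), §16.2 Theorem 16.4, §16.3 Theorem 16.5 and proof (p. 50).
-/

noncomputable section

open Finset

namespace Literature.NumberTheory.DiophantineGeometry

/-! ### Double counting over `r`-subsets -/

section Combinatorics

variable {α : Type*} [DecidableEq α]

/-- The `r`-subsets of `P` avoiding `p` are the `r`-subsets of `P.erase p`. [folklore] -/
theorem filter_not_mem_powersetCard_eq (P : Finset α) (r : ℕ) (p : α) :
    (P.powersetCard r).filter (fun T => p ∉ T) = (P.erase p).powersetCard r := by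
  ext T
  simp only [mem_filter, mem_powersetCard, subset_erase]
  tauto

/-- The number of `r`-subsets of `P` avoiding a given `p ∈ P` is `C(#P - 1, r)`. [folklore] -/
theorem card_filter_not_mem_powersetCard (P : Finset α) (r : ℕ) {p : α} (hp : p ∈ P) :
    ((P.powersetCard r).filter (fun T => p ∉ T)).card = (P.card - 1).choose r := by
  rw [filter_not_mem_powersetCard_eq, card_powersetCard, card_erase_of_mem hp]

/-- The number of `(r+1)`-subsets of `P` containing a given `p ∈ P` is `C(#P - 1, r)` (Pascal's
rule). [folklore] -/
theorem card_filter_mem_powersetCard (P : Finset α) (r : ℕ) {p : α} (hp : p ∈ P) :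
    ((P.powersetCard (r + 1)).filter (fun T => p ∈ T)).card = (P.card - 1).choose r := by
  have h := card_filter_add_card_filter_not (s := P.powersetCard (r + 1)) (fun T => p ∈ T)
  rw [card_filter_not_mem_powersetCard P (r + 1) hp, card_powersetCard] at h
  obtain ⟨m, hm⟩ : ∃ m, P.card = m + 1 :=
    ⟨P.card - 1, (Nat.succ_pred_eq_of_pos (card_pos.2 ⟨p, hp⟩)).symm⟩
  rw [hm, Nat.add_sub_cancel, Nat.choose_succ_succ'] at h
  rw [hm, Nat.add_sub_cancel]
  omega

/-- Double count: summing `f` over `P \ T` for all `r`-subsets `T ⊆ P` counts every `p ∈ P` exactly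
`C(#P - 1, r)` times. [folklore] -/
theorem sum_powersetCard_sum_sdiff (P : Finset α) (r : ℕ) (f : α → ℝ) :
    ∑ T ∈ P.powersetCard r, ∑ p ∈ P \ T, f p = ((P.card - 1).choose r : ℝ) * ∑ p ∈ P, f p := by
  have h1 : ∀ T ∈ P.powersetCard r, ∑ p ∈ P \ T, f p = ∑ p ∈ P, if p ∉ T then f p else 0 :=
    fun T _ => by rw [sdiff_eq_filter, sum_filter]
  have h2 : ∀ p ∈ P, ∑ T ∈ P.powersetCard r, (if p ∉ T then f p else 0) =
      ((P.card - 1).choose r : ℝ) * f p := fun p hp => by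
    rw [← sum_filter, sum_const, nsmul_eq_mul, card_filter_not_mem_powersetCard P r hp]
  rw [sum_congr rfl h1, sum_comm, sum_congr rfl h2, ← mul_sum]

/-- Double count: summing `g` over `T` for all `(r+1)`-subsets `T ⊆ P` counts every `p ∈ P` exactly
`C(#P - 1, r)` times. [folklore] -/
theorem sum_powersetCard_succ_sum (P : Finset α) (r : ℕ) (g : α → ℝ) :
    ∑ T ∈ P.powersetCard (r + 1), ∑ p ∈ T, g p = ((P.card - 1).choose r : ℝ) * ∑ p ∈ P, g p := by
  have h1 : ∀ T ∈ P.powersetCard (r + 1), ∑ p ∈ T, g p = ∑ p ∈ P, if p ∈ T then g p else 0 :=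
    fun T hT => by
      rw [← sum_filter, filter_mem_eq_inter, inter_eq_right.2 (mem_powersetCard.1 hT).1]
  have h2 : ∀ p ∈ P, ∑ T ∈ P.powersetCard (r + 1), (if p ∈ T then g p else 0) =
      ((P.card - 1).choose r : ℝ) * g p := fun p hp => by
    rw [← sum_filter, sum_const, nsmul_eq_mul, card_filter_mem_powersetCard P r hp]
  rw [sum_congr rfl h1, sum_comm, sum_congr rfl h2, ← mul_sum]

end Combinatorics

/-! ### Admissible factorisations of a squarefree conductor -/

/-- For squarefree `N` with prime-factor set `P` and a `3`-subset `T ⊆ P` (Pasten's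
`M = p_j p_{j+1} p_{j+2}`), the complementary divisor `D = ∏_{p ∈ P \ T} p` satisfies `D ∣ N`,
`primeFactors D = P \ T`, `N / D = ∏_{p ∈ T} p = M`, and `M` is not prime.
[cite: PastenShimura2024, proof of Theorem 16.5 (arXiv numbering)] -/
theorem sdiff_prod_admissible {N : ℕ} (hN : Squarefree N) {T : Finset ℕ}
    (hT : T ∈ N.primeFactors.powersetCard 3) :
    (∏ p ∈ N.primeFactors \ T, p) ∣ N ∧
      (∏ p ∈ N.primeFactors \ T, p).primeFactors = N.primeFactors \ T ∧
      N / (∏ p ∈ N.primeFactors \ T, p) = ∏ p ∈ T, p ∧ ¬ (∏ p ∈ T, p).Prime := by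
  have hTP : T ⊆ N.primeFactors := (mem_powersetCard.1 hT).1
  have hprod : (∏ p ∈ N.primeFactors \ T, p) * ∏ p ∈ T, p = N := by
    rw [prod_sdiff hTP, Nat.prod_primeFactors_of_squarefree hN]
  have hDpos : 0 < ∏ p ∈ N.primeFactors \ T, p :=
    prod_pos fun p hp => (Nat.prime_of_mem_primeFactors (sdiff_subset hp)).pos
  refine ⟨⟨_, hprod.symm⟩, Nat.primeFactors_prod fun p hp =>
    Nat.prime_of_mem_primeFactors (sdiff_subset hp), Nat.div_eq_of_eq_mul_right hDpos hprod.symm,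
    fun hprime => ?_⟩
  have h1 := congrArg Finset.card hprime.primeFactors
  rw [Nat.primeFactors_prod fun p hp => Nat.prime_of_mem_primeFactors (hTP hp),
    (mem_powersetCard.1 hT).2, card_singleton] at h1
  exact absurd h1 (by norm_num)

/-! ### The `(n-3)`-rd root step -/

/-- `log ∏ f = ∑ log f` for a product of nonzero naturals, cast to `ℝ`. [folklore] -/
theorem log_cast_prod_eq_sum {s : Finset ℕ} {f : ℕ → ℕ} (hf : ∀ p ∈ s, f p ≠ 0) :
    Real.log ((∏ p ∈ s, f p : ℕ) : ℝ) = ∑ p ∈ s, Real.log (f p : ℝ) := by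
  rw [Nat.cast_prod, Real.log_prod]
  exact fun p hp => by exact_mod_cast hf p hp

/-- **The `(n-3)`-rd-root step** of Pasten's proof of Theorem 16.5, second part (arXiv p. 50), in
logarithmic, multiplied-out form.  `P` is a set of primes (the prime factors of the squarefree
conductor `N = ∏_{p ∈ P} p`), `n = #P > 3`, `v p ≥ 1` on `P` (the valuations `v_p(Δ_E)`),
`e = 8/3 + ε'`, `x = 8/3 + ε` with `n·e + 3 ≤ (n-3)·x`.  If `∏_{p ∈ P \ T} v p < N^e · ∏_{p ∈ T} p`
for every `3`-subset `T ⊆ P` (`M = ∏_{p∈T} p`, `D = N/M`), then `∏_{p ∈ P} v p < N^x`: summing the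
logarithmic inequalities over all `T`, each `log v p` is counted `C(n-1,3)` times and `log N` gets
the multiplicity `C(n,3)·e + C(n-1,2)`, and `C(n-1,3)·n = C(n,3)·(n-3)`, `3·C(n-1,3) = C(n-1,2)·(n-3)`.
[cite: PastenShimura2024, proof of Theorem 16.5 (arXiv numbering)] -/
theorem prod_lt_rpow_of_forall_triple {P : Finset ℕ} (hP : ∀ p ∈ P, p.Prime) {v : ℕ → ℕ}
    (hv : ∀ p ∈ P, 0 < v p) {e x : ℝ} (h3 : 3 < P.card)
    (hkey : (P.card : ℝ) * e + 3 ≤ ((P.card : ℝ) - 3) * x)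
    (hT : ∀ T ∈ P.powersetCard 3,
      ((∏ p ∈ P \ T, v p : ℕ) : ℝ) < ((∏ p ∈ P, p : ℕ) : ℝ) ^ e * ((∏ p ∈ T, p : ℕ) : ℝ)) :
    ((∏ p ∈ P, v p : ℕ) : ℝ) < ((∏ p ∈ P, p : ℕ) : ℝ) ^ x := by
  have hNpos : (0 : ℝ) < ((∏ p ∈ P, p : ℕ) : ℝ) := by exact_mod_cast prod_pos fun p hp => (hP p hp).pos
  have hN1 : (1 : ℝ) ≤ ((∏ p ∈ P, p : ℕ) : ℝ) := by
    exact_mod_cast Nat.one_le_iff_ne_zero.2 (prod_pos fun p hp => (hP p hp).pos).ne'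
  have hlogN : 0 ≤ Real.log ((∏ p ∈ P, p : ℕ) : ℝ) := Real.log_nonneg hN1
  have hlogN_sum : Real.log ((∏ p ∈ P, p : ℕ) : ℝ) = ∑ p ∈ P, Real.log (p : ℝ) :=
    log_cast_prod_eq_sum (f := fun p => p) fun p hp => (hP p hp).ne_zero
  have hVpos : (0 : ℝ) < ((∏ p ∈ P, v p : ℕ) : ℝ) := by exact_mod_cast prod_pos fun p hp => hv p hp
  have hlogV := log_cast_prod_eq_sum (s := P) fun p hp => (hv p hp).ne'
  -- Step 1: the hypothesis in logarithmic form, for each triple `T`.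
  have hT' : ∀ T ∈ P.powersetCard 3, ∑ p ∈ P \ T, Real.log (v p : ℝ) <
      e * Real.log ((∏ p ∈ P, p : ℕ) : ℝ) + ∑ p ∈ T, Real.log (p : ℝ) := by
    intro T hTm
    have hTP : T ⊆ P := (mem_powersetCard.1 hTm).1
    have hlhs : (0 : ℝ) < ((∏ p ∈ P \ T, v p : ℕ) : ℝ) := by
      exact_mod_cast prod_pos fun p hp => hv p (sdiff_subset hp)
    have hMpos : (0 : ℝ) < ((∏ p ∈ T, p : ℕ) : ℝ) := by exact_mod_cast prod_pos fun p hp => (hP p (hTP hp)).pos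
    have eq2 : Real.log ((((∏ p ∈ P, p : ℕ) : ℝ) ^ e) * ((∏ p ∈ T, p : ℕ) : ℝ)) =
        e * Real.log ((∏ p ∈ P, p : ℕ) : ℝ) + ∑ p ∈ T, Real.log (p : ℝ) := by
      rw [Real.log_mul (Real.rpow_pos_of_pos hNpos e).ne' hMpos.ne', Real.log_rpow hNpos,
        log_cast_prod_eq_sum (f := fun p => p) fun p hp => (hP p (hTP hp)).ne_zero]
    have h := Real.log_lt_log hlhs (hT T hTm)
    rwa [log_cast_prod_eq_sum (s := P \ T) fun p hp => (hv p (sdiff_subset hp)).ne', eq2] at h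
  -- Step 2: sum over all triples, double count, rewrite `#P = k + 3`.
  have hsum := sum_lt_sum_of_nonempty (powersetCard_nonempty.2 h3.le) hT'
  rw [sum_powersetCard_sum_sdiff, sum_add_distrib, sum_const, card_powersetCard, nsmul_eq_mul,
    sum_powersetCard_succ_sum P 2, ← hlogN_sum, ← hlogV] at hsum
  obtain ⟨k, hk⟩ : ∃ k, P.card = k + 3 := ⟨P.card - 3, by omega⟩
  have hkpos : (0 : ℝ) < k := by exact_mod_cast (show 0 < k by omega)
  rw [hk] at hkey hsum; rw [show k + 3 - 1 = k + 2 by omega] at hsum; push_cast at hkey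
  -- hsum : C(k+2,3) * log V < C(k+3,3) * (e * log N) + C(k+2,2) * log N
  -- Step 3: the binomial identities, multiplied by `k`, give `log V < x * log N`.
  have id1 : (((k + 2).choose 3 : ℕ) : ℝ) * ((k : ℝ) + 3) = (((k + 3).choose 3 : ℕ) : ℝ) * k := by
    have h := Nat.choose_mul_succ_eq (k + 2) 3
    rw [show k + 2 + 1 = k + 3 by ring, show k + 3 - 3 = k by omega] at h
    exact_mod_cast h
  have id2 : (((k + 2).choose 3 : ℕ) : ℝ) * 3 = (((k + 2).choose 2 : ℕ) : ℝ) * k := by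
    have h := Nat.choose_succ_right_eq (k + 2) 2
    rw [show k + 2 - 2 = k by omega] at h
    exact_mod_cast h
  have hApos : (0 : ℝ) < (((k + 2).choose 3 : ℕ) : ℝ) := by exact_mod_cast Nat.choose_pos (by omega)
  have hmain : Real.log ((∏ p ∈ P, v p : ℕ) : ℝ) < x * Real.log ((∏ p ∈ P, p : ℕ) : ℝ) := by
    set A : ℝ := (((k + 2).choose 3 : ℕ) : ℝ)
    set B : ℝ := (((k + 3).choose 3 : ℕ) : ℝ)
    set C : ℝ := (((k + 2).choose 2 : ℕ) : ℝ)
    set L : ℝ := Real.log ((∏ p ∈ P, v p : ℕ) : ℝ)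
    set lN : ℝ := Real.log ((∏ p ∈ P, p : ℕ) : ℝ)
    have h2 : (k : ℝ) * (B * (e * lN) + C * lN) = A * (((k : ℝ) + 3) * e + 3) * lN := by
      calc (k : ℝ) * (B * (e * lN) + C * lN) = (B * k) * (e * lN) + (C * k) * lN := by ring
        _ = A * ((k : ℝ) + 3) * (e * lN) + A * 3 * lN := by rw [← id1, ← id2]
        _ = A * (((k : ℝ) + 3) * e + 3) * lN := by ring
    have h4 : (k : ℝ) * (A * L) < (k : ℝ) * (A * (x * lN)) :=
      calc (k : ℝ) * (A * L) < (k : ℝ) * (B * (e * lN) + C * lN) := mul_lt_mul_of_pos_left hsum hkpos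
        _ = A * (((k : ℝ) + 3) * e + 3) * lN := h2
        _ ≤ A * ((k : ℝ) * x) * lN :=
          mul_le_mul_of_nonneg_right (mul_le_mul_of_nonneg_left (by simpa using hkey) hApos.le) hlogN
        _ = (k : ℝ) * (A * (x * lN)) := by ring
    exact lt_of_mul_lt_mul_left (lt_of_mul_lt_mul_left h4 hkpos.le) hApos.le
  rwa [← Real.log_rpow hNpos, Real.log_lt_log_iff hVpos (Real.rpow_pos_of_pos hNpos x)] at hmain

/-! ### One curve of large conductor: both parities -/

/-- Pasten's proof of Theorem 16.5 (second part) for ONE semi-stable curve of large conductor, as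
arithmetic on the conductor `N` (squarefree, `n = ω(N) > 3`) and the minimal discriminant norm `Δ`:
if Theorem 16.4 (i) holds at `N` with exponent `8/3 + ε'` (hypothesis `H`: for every divisor
`1 < D ∣ N` with an even number of prime factors and `N/D` not prime,
`∏_{p ∣ D} v_p(Δ) < N^{8/3+ε'} · (N/D)`), `ε' ≤ ε` and `n ε' + 11 ≤ (n-3) ε`, then
`∏_{p ∣ N} v_p(Δ) < N^{8/3+ε}` (even `n`: `D = N`, `M = 1`; odd `n`: `M =` three primes, `D = N/M`).
[cite: PastenShimura2024, proof of Theorem 16.5 (arXiv numbering)] -/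
theorem prod_lt_rpow_of_thm_16_4_at {N Δ : ℕ} {ε ε' : ℝ} (hε'le : ε' ≤ ε)
    (hsq : Squarefree N) (h3 : 3 < N.primeFactors.card)
    (hkey : (N.primeFactors.card : ℝ) * ε' + 11 ≤ ((N.primeFactors.card : ℝ) - 3) * ε)
    (H : ∀ D : ℕ, 1 < D → D ∣ N → Even D.primeFactors.card → ¬ (N / D).Prime →
      ((∏ p ∈ D.primeFactors, Δ.factorization p : ℕ) : ℝ) <
        (N : ℝ) ^ (8 / 3 + ε' : ℝ) * ((N / D : ℕ) : ℝ)) :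
    ((∏ p ∈ N.primeFactors, Δ.factorization p : ℕ) : ℝ) < (N : ℝ) ^ (8 / 3 + ε : ℝ) := by
  have hN0 : N ≠ 0 := hsq.ne_zero
  have hNpos : (0 : ℝ) < N := by exact_mod_cast Nat.pos_of_ne_zero hN0
  have hN1 : (1 : ℝ) ≤ N := by exact_mod_cast Nat.pos_of_ne_zero hN0
  have h1N : 1 < N := by
    refine Nat.one_lt_iff_ne_zero_and_ne_one.2 ⟨hN0, fun h1 => ?_⟩
    rw [h1, Nat.primeFactors_one, card_empty] at h3
    omega
  have hPprime : ∀ p ∈ N.primeFactors, p.Prime := fun p hp => Nat.prime_of_mem_primeFactors hp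
  have hNprod : ∏ p ∈ N.primeFactors, p = N := Nat.prod_primeFactors_of_squarefree hsq
  rcases Nat.even_or_odd N.primeFactors.card with heven | hodd
  · -- `n` even: `D = N`, `M = 1`.
    have h := H N h1N dvd_rfl heven (by rw [Nat.div_self (Nat.pos_of_ne_zero hN0)]; exact Nat.not_prime_one)
    rw [Nat.div_self (Nat.pos_of_ne_zero hN0), Nat.cast_one, mul_one] at h
    exact h.trans_le (Real.rpow_le_rpow_of_exponent_le hN1 (by linarith))
  · -- `n` odd: all triples.
    by_cases hV0 : ∏ p ∈ N.primeFactors, Δ.factorization p = 0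
    · rw [hV0, Nat.cast_zero]
      exact Real.rpow_pos_of_pos hNpos _
    have hvpos : ∀ p ∈ N.primeFactors, 0 < Δ.factorization p := fun p hp =>
      Nat.pos_of_ne_zero fun h0 => hV0 (prod_eq_zero hp h0)
    have hkey' : (N.primeFactors.card : ℝ) * (8 / 3 + ε') + 3 ≤
        ((N.primeFactors.card : ℝ) - 3) * (8 / 3 + ε) := by
      have e1 : (N.primeFactors.card : ℝ) * (8 / 3 + ε') + 3 - ((N.primeFactors.card : ℝ) - 3) *
          (8 / 3 + ε) = ((N.primeFactors.card : ℝ) * ε' + 11) - ((N.primeFactors.card : ℝ) - 3) * ε := by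
        ring
      linarith
    have key := prod_lt_rpow_of_forall_triple hPprime hvpos (e := 8 / 3 + ε') (x := 8 / 3 + ε)
      h3 hkey' ?_
    · rwa [hNprod] at key
    · intro T hT
      obtain ⟨hdvd, hpf, hdiv, hnp⟩ := sdiff_prod_admissible hsq hT
      have hcard : (N.primeFactors \ T).card = N.primeFactors.card - 3 := by
        rw [card_sdiff_of_subset (mem_powersetCard.1 hT).1, (mem_powersetCard.1 hT).2]
      have h1D : 1 < ∏ p ∈ N.primeFactors \ T, p := by
        refine Nat.one_lt_iff_ne_zero_and_ne_one.2
          ⟨(prod_pos fun p hp => (hPprime p (sdiff_subset hp)).pos).ne', fun h1 => ?_⟩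
        have h0 : (N.primeFactors \ T).card = 0 := by
          rw [← hpf, h1, Nat.primeFactors_one, card_empty]
        omega
      have heven : Even (∏ p ∈ N.primeFactors \ T, p).primeFactors.card := by
        rw [hpf, hcard]
        obtain ⟨m, hm⟩ := hodd
        exact ⟨m - 1, by omega⟩
      have h := H _ h1D hdvd heven (by rw [hdiv]; exact hnp)
      rw [hpf, hdiv] at h
      rwa [hNprod]

/-! ### Theorem 16.5, second part, from Theorem 16.4 (i) -/

/-- **Assembly of the printed proof of Theorem 16.5, second part** (arXiv:1705.09251 §16.3, p. 50),
with the absorption of the small conductors made a parameter.  Hypotheses: `h164` = Theorem 16.4 (i)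
of loc. cit. in the semi-stable case, stated for squarefree conductors `N ≥ N_0(ε)`, divisors
`1 < D ∣ N` with an even number of prime factors (admissible `N = DM`) and `M = N/D` not prime:
`∏_{p ∣ D} v_p(Δ_E) < N^{8/3+ε} · M` — an explicit hypothesis, NOT a vendored fact (D-0026); and
`hB` = ANY bound `∏_{p ∣ N_E} v_p(Δ_E) < K_1 · N_E^e` (`e ≥ 0`) valid for the semi-stable `E/ℚ` with
at least two places of bad reduction, used only to absorb the conductors `< N_0` into the constant
(the print discards these finitely many curves by Shafarevich's theorem, p. 12 — declared deviation;
below `hB` is fed by Theorem 1.12, `pastenShimura2024_thm_16_5_manyPrimes_strict_of_thm_16_4`, or by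
Corollary 16.2 with `S = ∅`, `pastenShimura2024_thm_16_5_manyPrimes_strict_of_cor_16_2_of_thm_16_4`).
Conclusion: for every `ε > 0` there is `K > 0` such that every semi-stable `E/ℚ` with MORE THAN
`3 + 11/ε` places of bad reduction has `∏_{p ∣ N_E} v_p(Δ_E) < K · N_E^{8/3+ε}`.  Constants:
`n_0 = ⌊3 + 11/ε⌋ + 1`, `ε' = ((n_0 - 3) ε - 11)/n_0 ∈ (0, ε]`, `N_0 = N_0(ε')`,
`K = max (K_1 · N_0^e) 1`. [cite: PastenShimura2024, Theorem 16.5 (arXiv numbering) second part with its proof] -/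
theorem pastenShimura2024_thm_16_5_manyPrimes_strict_of_bound_of_thm_16_4 {e : ℝ} (he : 0 ≤ e)
    (hB : ∃ K₁ : ℝ, 0 < K₁ ∧ ∀ (W : WeierstrassCurve ℚ) [W.IsElliptic],
      Squarefree (W.conductorNorm ℤ) → 2 ≤ (W.conductorNorm ℤ).primeFactors.card →
        ((∏ p ∈ (W.conductorNorm ℤ).primeFactors,
            (W.minimalDiscriminantNorm ℤ).factorization p : ℕ) : ℝ)
          < K₁ * (W.conductorNorm ℤ : ℝ) ^ e)
    (h164 : ∀ ε : ℝ, 0 < ε → ∃ N₀ : ℕ, ∀ (W : WeierstrassCurve ℚ) [W.IsElliptic],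
      Squarefree (W.conductorNorm ℤ) → N₀ ≤ W.conductorNorm ℤ →
        ∀ D : ℕ, 1 < D → D ∣ W.conductorNorm ℤ → Even D.primeFactors.card →
          ¬ (W.conductorNorm ℤ / D).Prime →
            ((∏ p ∈ D.primeFactors, (W.minimalDiscriminantNorm ℤ).factorization p : ℕ) : ℝ)
              < (W.conductorNorm ℤ : ℝ) ^ (8 / 3 + ε : ℝ) * ((W.conductorNorm ℤ / D : ℕ) : ℝ)) :
    ∀ ε : ℝ, 0 < ε → ∃ K : ℝ, 0 < K ∧ ∀ (W : WeierstrassCurve ℚ) [W.IsElliptic],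
      Squarefree (W.conductorNorm ℤ) →
        (3 : ℝ) + 11 / ε < ((W.conductorNorm ℤ).primeFactors.card : ℝ) →
          ((∏ p ∈ (W.conductorNorm ℤ).primeFactors,
              (W.minimalDiscriminantNorm ℤ).factorization p : ℕ) : ℝ)
            < K * (W.conductorNorm ℤ : ℝ) ^ (8 / 3 + ε : ℝ) := by
  intro ε hε
  have h11 : (0 : ℝ) < 11 / ε := by positivity
  -- `n₀` = the least integer `> 3 + 11/ε`, and `ε'`.
  obtain ⟨n₀, hn₀⟩ : ∃ n₀ : ℕ, n₀ = ⌊(3 : ℝ) + 11 / ε⌋₊ + 1 := ⟨_, rfl⟩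
  have hn₀gt : (3 : ℝ) + 11 / ε < n₀ := by
    rw [hn₀]; exact_mod_cast Nat.lt_floor_add_one ((3 : ℝ) + 11 / ε)
  have hn₀pos : (0 : ℝ) < n₀ := by linarith
  obtain ⟨ε', hε'⟩ : ∃ ε' : ℝ, ε' = (((n₀ : ℝ) - 3) * ε - 11) / n₀ := ⟨_, rfl⟩
  have hε'n₀ : ε' * n₀ = ((n₀ : ℝ) - 3) * ε - 11 := by rw [hε']; field_simp
  have hε'pos : 0 < ε' := by
    have h2 := (div_lt_iff₀ hε).1 (show 11 / ε < (n₀ : ℝ) - 3 by linarith)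
    exact hε' ▸ div_pos (by linarith) hn₀pos
  have hε'le : ε' ≤ ε := by rw [hε', div_le_iff₀ hn₀pos]; nlinarith
  obtain ⟨N₀, hN₀⟩ := h164 ε' hε'pos
  obtain ⟨K₁, hK₁pos, hK₁⟩ := hB
  have hKpos : (0 : ℝ) < max (K₁ * (N₀ : ℝ) ^ e) 1 := lt_max_of_lt_right one_pos
  refine ⟨max (K₁ * (N₀ : ℝ) ^ e) 1, hKpos, fun W _ hsq hn => ?_⟩
  have hcard2 : 2 ≤ (W.conductorNorm ℤ).primeFactors.card := by
    have h3 : 3 < (W.conductorNorm ℤ).primeFactors.card := by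
      exact_mod_cast (show (3 : ℝ) < (W.conductorNorm ℤ).primeFactors.card by linarith)
    omega
  -- Generalise the conductor and the minimal discriminant norm of `W` to plain naturals `N`, `Δ`.
  obtain ⟨N, hN⟩ : ∃ N : ℕ, W.conductorNorm ℤ = N := ⟨_, rfl⟩
  obtain ⟨Δ, hΔ⟩ : ∃ Δ : ℕ, W.minimalDiscriminantNorm ℤ = Δ := ⟨_, rfl⟩
  have H164 : N₀ ≤ N → ∀ D : ℕ, 1 < D → D ∣ N → Even D.primeFactors.card → ¬ (N / D).Prime →
      ((∏ p ∈ D.primeFactors, Δ.factorization p : ℕ) : ℝ) <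
        (N : ℝ) ^ (8 / 3 + ε' : ℝ) * ((N / D : ℕ) : ℝ) := by
    have h := hN₀ W hsq; rwa [hN, hΔ] at h
  have HB : ((∏ p ∈ N.primeFactors, Δ.factorization p : ℕ) : ℝ) < K₁ * (N : ℝ) ^ e := by
    have h := hK₁ W hsq hcard2; rwa [hN, hΔ] at h
  rw [hN] at hsq hn
  rw [hN, hΔ]
  have hN0 : N ≠ 0 := hsq.ne_zero
  have hNpos : (0 : ℝ) < N := by exact_mod_cast Nat.pos_of_ne_zero hN0
  have hrpow_pos : 0 < (N : ℝ) ^ (8 / 3 + ε : ℝ) := Real.rpow_pos_of_pos hNpos _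
  have hrpow_one : 1 ≤ (N : ℝ) ^ (8 / 3 + ε : ℝ) :=
    Real.one_le_rpow (by exact_mod_cast Nat.pos_of_ne_zero hN0) (by positivity)
  by_cases hsmall : N < N₀
  · -- Small conductor: the absorbing bound `hB`.
    calc ((∏ p ∈ N.primeFactors, Δ.factorization p : ℕ) : ℝ)
        < K₁ * (N : ℝ) ^ e := HB
      _ ≤ K₁ * (N₀ : ℝ) ^ e := mul_le_mul_of_nonneg_left
          (Real.rpow_le_rpow hNpos.le (by exact_mod_cast hsmall.le) he) hK₁pos.le
      _ ≤ max (K₁ * (N₀ : ℝ) ^ e) 1 := le_max_left _ _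
      _ ≤ max (K₁ * (N₀ : ℝ) ^ e) 1 * (N : ℝ) ^ (8 / 3 + ε : ℝ) :=
          le_mul_of_one_le_right hKpos.le hrpow_one
  · -- Large conductor: the printed argument gives `∏ < N^{8/3+ε}` (constant `1`).
    rw [not_lt] at hsmall
    have hn₀le : n₀ ≤ N.primeFactors.card := by
      have h1 : ⌊(3 : ℝ) + 11 / ε⌋₊ < N.primeFactors.card := (Nat.floor_lt (by positivity)).2 hn
      omega
    have hn3 : 3 < N.primeFactors.card := by
      exact_mod_cast (show (3 : ℝ) < N.primeFactors.card by linarith)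
    have hkey : (N.primeFactors.card : ℝ) * ε' + 11 ≤ ((N.primeFactors.card : ℝ) - 3) * ε := by
      have hn' : (n₀ : ℝ) ≤ N.primeFactors.card := by exact_mod_cast hn₀le
      nlinarith [mul_nonneg (sub_nonneg.2 hn') (sub_nonneg.2 hε'le)]
    calc ((∏ p ∈ N.primeFactors, Δ.factorization p : ℕ) : ℝ)
        < (N : ℝ) ^ (8 / 3 + ε : ℝ) := prod_lt_rpow_of_thm_16_4_at hε'le hsq hn3 hkey (H164 hsmall)
      _ ≤ max (K₁ * (N₀ : ℝ) ^ e) 1 * (N : ℝ) ^ (8 / 3 + ε : ℝ) :=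
          le_mul_of_one_le_left hrpow_pos.le (le_max_right _ _)

/-- **Pasten, Theorem 16.5, second part, as established by the printed proof** (arXiv:1705.09251
§16.3, p. 50).  Hypotheses: `h164` = Theorem 16.4 (i) of loc. cit. in the semi-stable case, stated
for squarefree conductors `N ≥ N_0(ε)`, divisors `1 < D ∣ N` with an even number of prime factors
(admissible `N = DM`) and `M = N/D` not prime: `∏_{p ∣ D} v_p(Δ_E) < N^{8/3+ε} · M` — an explicit
hypothesis, NOT a vendored fact (D-0026); and `h112` = the named fact `pastenShimura2024_thm_1_12`
(Theorem 1.12 = Theorem 16.5, first part), used with exponent `11/2 + 1` only to absorb the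
conductors `< N_0` into the constant (the print invokes Shafarevich finiteness for this, p. 12 —
declared deviation).  Conclusion: for every `ε > 0` there is `K > 0` such that every semi-stable
`E/ℚ` with MORE THAN `3 + 11/ε` places of bad reduction has `∏_{p ∣ N_E} v_p(Δ_E) < K · N_E^{8/3+ε}`.
Constants: `n_0 = ⌊3 + 11/ε⌋ + 1`, `ε' = ((n_0 - 3) ε - 11)/n_0 ∈ (0, ε]`, `N_0 = N_0(ε')`,
`K = max (K_1 · N_0^{13/2}) 1`; boundary `n = 3 + 11/ε`: see the module docstring.
[cite: PastenShimura2024, Theorem 16.5 (arXiv numbering) second part with its proof] -/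
theorem pastenShimura2024_thm_16_5_manyPrimes_strict_of_thm_16_4
    (h112 : pastenShimura2024_thm_1_12)
    (h164 : ∀ ε : ℝ, 0 < ε → ∃ N₀ : ℕ, ∀ (W : WeierstrassCurve ℚ) [W.IsElliptic],
      Squarefree (W.conductorNorm ℤ) → N₀ ≤ W.conductorNorm ℤ →
        ∀ D : ℕ, 1 < D → D ∣ W.conductorNorm ℤ → Even D.primeFactors.card →
          ¬ (W.conductorNorm ℤ / D).Prime →
            ((∏ p ∈ D.primeFactors, (W.minimalDiscriminantNorm ℤ).factorization p : ℕ) : ℝ)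
              < (W.conductorNorm ℤ : ℝ) ^ (8 / 3 + ε : ℝ) * ((W.conductorNorm ℤ / D : ℕ) : ℝ)) :
    ∀ ε : ℝ, 0 < ε → ∃ K : ℝ, 0 < K ∧ ∀ (W : WeierstrassCurve ℚ) [W.IsElliptic],
      Squarefree (W.conductorNorm ℤ) →
        (3 : ℝ) + 11 / ε < ((W.conductorNorm ℤ).primeFactors.card : ℝ) →
          ((∏ p ∈ (W.conductorNorm ℤ).primeFactors,
              (W.minimalDiscriminantNorm ℤ).factorization p : ℕ) : ℝ)
            < K * (W.conductorNorm ℤ : ℝ) ^ (8 / 3 + ε : ℝ) := by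
  refine pastenShimura2024_thm_16_5_manyPrimes_strict_of_bound_of_thm_16_4 (e := 11 / 2 + 1)
    (by norm_num) ?_ h164
  obtain ⟨K₁, hK₁pos, hK₁⟩ := h112 1 one_pos
  exact ⟨K₁, hK₁pos, fun W _ hsq _ => hK₁ W hsq⟩

/-- **Theorem 16.5, second part (strict form), from Corollary 16.2 and Theorem 16.4 (i)** — the
dependency structure of §16 itself: the small conductors are absorbed through the named fact
`pastenShimura2024_cor_16_2` (Corollary 16.2, a consequence of Theorem 16.1) taken at `S = ∅`,
`ε = 1` — a semi-stable `E` with more than `3 + 11/ε ≥ 3` bad places has `≥ 2` primes of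
multiplicative reduction, every bad prime being multiplicative (`N_E` squarefree, so the product
over `p ∥ N_E` is the full product, `multiplicativeValuationProduct_eq_of_squarefree`) — instead of
Theorem 1.12, so that Mestre–Oesterlé (prime conductor) does not enter.  `h164` as in
`pastenShimura2024_thm_16_5_manyPrimes_strict_of_thm_16_4`.
[cite: PastenShimura2024, Theorem 16.5 (arXiv numbering) second part with its proof; Corollary 16.2] -/
theorem pastenShimura2024_thm_16_5_manyPrimes_strict_of_cor_16_2_of_thm_16_4
    (h162 : pastenShimura2024_cor_16_2)
    (h164 : ∀ ε : ℝ, 0 < ε → ∃ N₀ : ℕ, ∀ (W : WeierstrassCurve ℚ) [W.IsElliptic],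
      Squarefree (W.conductorNorm ℤ) → N₀ ≤ W.conductorNorm ℤ →
        ∀ D : ℕ, 1 < D → D ∣ W.conductorNorm ℤ → Even D.primeFactors.card →
          ¬ (W.conductorNorm ℤ / D).Prime →
            ((∏ p ∈ D.primeFactors, (W.minimalDiscriminantNorm ℤ).factorization p : ℕ) : ℝ)
              < (W.conductorNorm ℤ : ℝ) ^ (8 / 3 + ε : ℝ) * ((W.conductorNorm ℤ / D : ℕ) : ℝ)) :
    ∀ ε : ℝ, 0 < ε → ∃ K : ℝ, 0 < K ∧ ∀ (W : WeierstrassCurve ℚ) [W.IsElliptic],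
      Squarefree (W.conductorNorm ℤ) →
        (3 : ℝ) + 11 / ε < ((W.conductorNorm ℤ).primeFactors.card : ℝ) →
          ((∏ p ∈ (W.conductorNorm ℤ).primeFactors,
              (W.minimalDiscriminantNorm ℤ).factorization p : ℕ) : ℝ)
            < K * (W.conductorNorm ℤ : ℝ) ^ (8 / 3 + ε : ℝ) := by
  refine pastenShimura2024_thm_16_5_manyPrimes_strict_of_bound_of_thm_16_4 (e := 11 / 2 + 1)
    (by norm_num) ?_ h164
  obtain ⟨K₁, hK₁pos, hK₁⟩ := h162 ∅ 1 one_pos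
  refine ⟨K₁, hK₁pos, fun W _ hsq h2 => ?_⟩
  have hS : ∀ p : ℕ, p.Prime → p ∉ (∅ : Finset ℕ) → ¬ p ^ 2 ∣ W.conductorNorm ℤ :=
    fun p hp _ hp2 => hp.not_isUnit (hsq p (by simpa [sq] using hp2))
  have hfilter : ((W.conductorNorm ℤ).primeFactors.filter
      fun p => ¬ p ^ 2 ∣ W.conductorNorm ℤ) = (W.conductorNorm ℤ).primeFactors :=
    filter_true_of_mem fun p hp => hS p (Nat.prime_of_mem_primeFactors hp) (notMem_empty p)
  have h2' : 2 ≤ ((W.conductorNorm ℤ).primeFactors.filter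
      fun p => ¬ p ^ 2 ∣ W.conductorNorm ℤ).card := by rwa [hfilter]
  have hlt := hK₁ W hS h2'
  rwa [multiplicativeValuationProduct_eq_of_squarefree W hsq] at hlt

/-- From the strict form to the vendored form off the boundary: if `11/ε ∉ ℕ`, "at least `3 + 11/ε`
places" and "more than `3 + 11/ε` places" coincide, so at such an `ε` the conclusion of the named
fact `pastenShimura2024_thm_16_5_manyPrimes` follows from the strict statement (e.g. the conclusion
of `pastenShimura2024_thm_16_5_manyPrimes_strict_of_thm_16_4`).  The exceptional values are
`ε = 11/m`, `m ∈ ℕ`; see the module docstring. [cite: PastenShimura2024, Theorem 16.5 (arXiv numbering)] -/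
theorem pastenShimura2024_thm_16_5_manyPrimes_of_strict
    (hstrict : ∀ ε : ℝ, 0 < ε → ∃ K : ℝ, 0 < K ∧ ∀ (W : WeierstrassCurve ℚ) [W.IsElliptic],
      Squarefree (W.conductorNorm ℤ) →
        (3 : ℝ) + 11 / ε < ((W.conductorNorm ℤ).primeFactors.card : ℝ) →
          ((∏ p ∈ (W.conductorNorm ℤ).primeFactors,
              (W.minimalDiscriminantNorm ℤ).factorization p : ℕ) : ℝ)
            < K * (W.conductorNorm ℤ : ℝ) ^ (8 / 3 + ε : ℝ))
    {ε : ℝ} (hε : 0 < ε) (hnat : ∀ m : ℕ, (11 : ℝ) / ε ≠ m) :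
    ∃ K : ℝ, 0 < K ∧ ∀ (W : WeierstrassCurve ℚ) [W.IsElliptic],
      Squarefree (W.conductorNorm ℤ) →
        (3 : ℝ) + 11 / ε ≤ ((W.conductorNorm ℤ).primeFactors.card : ℝ) →
          ((∏ p ∈ (W.conductorNorm ℤ).primeFactors,
              (W.minimalDiscriminantNorm ℤ).factorization p : ℕ) : ℝ)
            < K * (W.conductorNorm ℤ : ℝ) ^ (8 / 3 + ε : ℝ) := by
  obtain ⟨K, hK, h⟩ := hstrict ε hε
  refine ⟨K, hK, fun W _ hsq hn => h W hsq (lt_of_le_of_ne hn fun heq => ?_)⟩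
  have h3 : 3 ≤ (W.conductorNorm ℤ).primeFactors.card := by
    exact_mod_cast (show (3 : ℝ) ≤ (W.conductorNorm ℤ).primeFactors.card by linarith [show (0 : ℝ) < 11 / ε by positivity])
  refine hnat ((W.conductorNorm ℤ).primeFactors.card - 3) ?_
  push_cast [h3]
  linarith

/-! ### The boundary `n = 3 + 11/ε`

The printed proof covers `n > 3 + 11/ε`; at `n = 3 + 11/ε` (so `11/ε = m ∈ ℕ`, `n = m + 3`) the paper's
results still give the display when `n` is even (Theorem 16.4 (i) with `D = N`, `M = 1`) and when
`n ∈ {5, 7, 9, 11}` (Theorem 16.1 with `D = N/p_i` over all `i`, the device of the proof of Corollary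
16.2: exponent `(11/3 + ε')·n/(n-1) < 8/3 + 11/(n-3)` iff `n ≤ 11`, with room `≥ 1/12` for `ε' = 1/132`).
The theorem `pastenShimura2024_thm_16_5_manyPrimes_of_thm_1_12_of_thm_16_1_of_thm_16_4` below records
exactly this: the vendored "at least" form at every `ε > 0` off the set `{11/m : m even, m ≥ 10}`, from
Theorem 1.12 (named fact), Theorem 16.1 (semi-stable case, `S = ∅`, inline hypothesis `h161`) and
Theorem 16.4 (i) (inline hypothesis `h164`). -/

/-- **The `(n-1)`-st-root step** (the device of the proof of Corollary 16.2, arXiv p. 49: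
`∏_{p ∣ N} v_p = (∏_i ∏_{p ∣ N/p_i} v_p)^{1/(n-1)}`), in logarithmic, multiplied-out form: `P` a set of
primes, `n = #P ≥ 2`, `v ≥ 1` on `P`, `n·e ≤ (n-1)·x`; if `∏_{p ∈ P, p ≠ p₀} v p < N^e` for every
`p₀ ∈ P` (`N = ∏_{p ∈ P} p`), then `∏_{p ∈ P} v p < N^x` (each `log v p` is counted `n - 1` times).
[cite: PastenShimura2024, proof of Corollary 16.2 (arXiv numbering)] -/
theorem prod_lt_rpow_of_forall_erase {P : Finset ℕ} (hP : ∀ p ∈ P, p.Prime) {v : ℕ → ℕ}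
    (hv : ∀ p ∈ P, 0 < v p) {e x : ℝ} (h2 : 2 ≤ P.card)
    (hkey : (P.card : ℝ) * e ≤ ((P.card : ℝ) - 1) * x)
    (hT : ∀ p₀ ∈ P, ((∏ p ∈ P.erase p₀, v p : ℕ) : ℝ) < ((∏ p ∈ P, p : ℕ) : ℝ) ^ e) :
    ((∏ p ∈ P, v p : ℕ) : ℝ) < ((∏ p ∈ P, p : ℕ) : ℝ) ^ x := by
  have hNpos : (0 : ℝ) < ((∏ p ∈ P, p : ℕ) : ℝ) := by exact_mod_cast prod_pos fun p hp => (hP p hp).pos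
  have hN1 : (1 : ℝ) ≤ ((∏ p ∈ P, p : ℕ) : ℝ) := by
    exact_mod_cast Nat.one_le_iff_ne_zero.2 (prod_pos fun p hp => (hP p hp).pos).ne'
  have hlogN : 0 ≤ Real.log ((∏ p ∈ P, p : ℕ) : ℝ) := Real.log_nonneg hN1
  have hVpos : (0 : ℝ) < ((∏ p ∈ P, v p : ℕ) : ℝ) := by exact_mod_cast prod_pos fun p hp => hv p hp
  have hlogV := log_cast_prod_eq_sum (s := P) fun p hp => (hv p hp).ne'
  -- Step 1: the hypothesis in logarithmic form, for each `p₀`.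
  have hT' : ∀ p₀ ∈ P, ∑ p ∈ P.erase p₀, Real.log (v p : ℝ) <
      e * Real.log ((∏ p ∈ P, p : ℕ) : ℝ) := by
    intro p₀ hp₀
    have hlhs : (0 : ℝ) < ((∏ p ∈ P.erase p₀, v p : ℕ) : ℝ) := by
      exact_mod_cast prod_pos fun p hp => hv p (mem_of_mem_erase hp)
    have h := Real.log_lt_log hlhs (hT p₀ hp₀)
    rwa [log_cast_prod_eq_sum (s := P.erase p₀) fun p hp => (hv p (mem_of_mem_erase hp)).ne',
      Real.log_rpow hNpos] at h
  -- Step 2: sum over `p₀ ∈ P`; each `log v p` appears `#P - 1` times.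
  have hsum := sum_lt_sum_of_nonempty (card_pos.1 (by omega)) hT'
  have hL : ∑ p₀ ∈ P, ∑ p ∈ P.erase p₀, Real.log (v p : ℝ) =
      ((P.card : ℝ) - 1) * ∑ p ∈ P, Real.log (v p : ℝ) := by
    rw [sum_congr rfl fun p₀ hp₀ => sum_erase_eq_sub hp₀, sum_sub_distrib, sum_const, nsmul_eq_mul]
    ring
  rw [hL, sum_const, nsmul_eq_mul, ← hlogV] at hsum
  -- hsum : (#P - 1) * log V < #P * (e * log N)
  have hn1 : (0 : ℝ) < (P.card : ℝ) - 1 := by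
    have h2' : (2 : ℝ) ≤ P.card := by exact_mod_cast h2
    linarith
  have hmain : Real.log ((∏ p ∈ P, v p : ℕ) : ℝ) < x * Real.log ((∏ p ∈ P, p : ℕ) : ℝ) := by
    have h3 : ((P.card : ℝ) - 1) * Real.log ((∏ p ∈ P, v p : ℕ) : ℝ) <
        ((P.card : ℝ) - 1) * (x * Real.log ((∏ p ∈ P, p : ℕ) : ℝ)) :=
      calc ((P.card : ℝ) - 1) * Real.log ((∏ p ∈ P, v p : ℕ) : ℝ)
          < (P.card : ℝ) * (e * Real.log ((∏ p ∈ P, p : ℕ) : ℝ)) := hsum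
        _ = ((P.card : ℝ) * e) * Real.log ((∏ p ∈ P, p : ℕ) : ℝ) := by ring
        _ ≤ (((P.card : ℝ) - 1) * x) * Real.log ((∏ p ∈ P, p : ℕ) : ℝ) :=
            mul_le_mul_of_nonneg_right hkey hlogN
        _ = ((P.card : ℝ) - 1) * (x * Real.log ((∏ p ∈ P, p : ℕ) : ℝ)) := by ring
    exact lt_of_mul_lt_mul_left h3 hn1.le
  rwa [← Real.log_rpow hNpos, Real.log_lt_log_iff hVpos (Real.rpow_pos_of_pos hNpos x)] at hmain

/-- For squarefree `N` and a prime factor `p₀` of `N`, the complementary divisor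
`D = ∏_{p ∣ N, p ≠ p₀} p = N/p₀` satisfies `D ∣ N` and `primeFactors D = primeFactors N ∖ {p₀}`
(the admissible factorisation `D = N/p_i`, `M = p_i` of the proof of Corollary 16.2).
[cite: PastenShimura2024, proof of Corollary 16.2 (arXiv numbering)] -/
theorem erase_prod_admissible {N : ℕ} (hN : Squarefree N) {p₀ : ℕ} (hp₀ : p₀ ∈ N.primeFactors) :
    (∏ p ∈ N.primeFactors.erase p₀, p) ∣ N ∧
      (∏ p ∈ N.primeFactors.erase p₀, p).primeFactors = N.primeFactors.erase p₀ := by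
  have hprod : (∏ p ∈ N.primeFactors.erase p₀, p) * p₀ = N := by
    rw [prod_erase_mul _ _ hp₀, Nat.prod_primeFactors_of_squarefree hN]
  exact ⟨⟨p₀, hprod.symm⟩,
    Nat.primeFactors_prod fun p hp => Nat.prime_of_mem_primeFactors (mem_of_mem_erase hp)⟩

/-- Theorem 16.1 (semi-stable case) for ONE curve of large squarefree conductor `N` with an ODD number
`n ≥ 3` of prime factors, as arithmetic: if `∏_{p ∣ D} v_p(Δ) < N^e` for every divisor `1 < D ∣ N`
with an even number of prime factors (hypothesis `H`, Theorem 16.1 at `N` with `e = 11/3 + ε'`) and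
`n·e ≤ (n-1)·x`, then `∏_{p ∣ N} v_p(Δ) < N^x` (`D = N/p_i` for each `i`, `(n-1)`-st roots).
[cite: PastenShimura2024, Theorem 16.1 and proof of Corollary 16.2 (arXiv numbering)] -/
theorem prod_lt_rpow_of_thm_16_1_at {N Δ : ℕ} {e x : ℝ} (hsq : Squarefree N)
    (hodd : Odd N.primeFactors.card) (h3 : 3 ≤ N.primeFactors.card)
    (hkey : (N.primeFactors.card : ℝ) * e ≤ ((N.primeFactors.card : ℝ) - 1) * x)
    (H : ∀ D : ℕ, 1 < D → D ∣ N → Even D.primeFactors.card →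
      ((∏ p ∈ D.primeFactors, Δ.factorization p : ℕ) : ℝ) < (N : ℝ) ^ e) :
    ((∏ p ∈ N.primeFactors, Δ.factorization p : ℕ) : ℝ) < (N : ℝ) ^ x := by
  have hN0 : N ≠ 0 := hsq.ne_zero
  have hNpos : (0 : ℝ) < N := by exact_mod_cast Nat.pos_of_ne_zero hN0
  have hPprime : ∀ p ∈ N.primeFactors, p.Prime := fun p hp => Nat.prime_of_mem_primeFactors hp
  have hNprod : ∏ p ∈ N.primeFactors, p = N := Nat.prod_primeFactors_of_squarefree hsq
  by_cases hV0 : ∏ p ∈ N.primeFactors, Δ.factorization p = 0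
  · rw [hV0, Nat.cast_zero]
    exact Real.rpow_pos_of_pos hNpos _
  have hvpos : ∀ p ∈ N.primeFactors, 0 < Δ.factorization p := fun p hp =>
    Nat.pos_of_ne_zero fun h0 => hV0 (prod_eq_zero hp h0)
  have key := prod_lt_rpow_of_forall_erase hPprime hvpos (e := e) (x := x) (by omega) hkey ?_
  · rwa [hNprod] at key
  · intro p₀ hp₀
    obtain ⟨hdvd, hpf⟩ := erase_prod_admissible hsq hp₀
    have hcard : (N.primeFactors.erase p₀).card = N.primeFactors.card - 1 := card_erase_of_mem hp₀
    have h1D : 1 < ∏ p ∈ N.primeFactors.erase p₀, p := by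
      refine Nat.one_lt_iff_ne_zero_and_ne_one.2
        ⟨(prod_pos fun p hp => (hPprime p (mem_of_mem_erase hp)).pos).ne', fun h1 => ?_⟩
      have h0 : (N.primeFactors.erase p₀).card = 0 := by
        rw [← hpf, h1, Nat.primeFactors_one, card_empty]
      omega
    have heven : Even (∏ p ∈ N.primeFactors.erase p₀, p).primeFactors.card := by
      rw [hpf, hcard]
      obtain ⟨m, hm⟩ := hodd
      exact ⟨m, by omega⟩
    have h := H _ h1D hdvd heven
    rw [hpf] at h
    rwa [hNprod]

/-- Theorem 16.4 (i) with `D = N`, `M = 1` for ONE curve of squarefree conductor `N > 1` with an EVEN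
number of prime factors: `∏_{p ∣ N} v_p(Δ) < N^{8/3+ε'} ≤ N^{8/3+ε}` (`ε' ≤ ε`) — the even case of the
printed proof of Theorem 16.5, second part, which needs no root trick and hence no strict inequality
`n > 3 + 11/ε`. [cite: PastenShimura2024, proof of Theorem 16.5 (arXiv numbering)] -/
theorem prod_lt_rpow_of_thm_16_4_at_even {N Δ : ℕ} {ε ε' : ℝ} (hε'le : ε' ≤ ε)
    (hsq : Squarefree N) (h0 : 0 < N.primeFactors.card) (heven : Even N.primeFactors.card)
    (H : ∀ D : ℕ, 1 < D → D ∣ N → Even D.primeFactors.card → ¬ (N / D).Prime →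
      ((∏ p ∈ D.primeFactors, Δ.factorization p : ℕ) : ℝ) <
        (N : ℝ) ^ (8 / 3 + ε' : ℝ) * ((N / D : ℕ) : ℝ)) :
    ((∏ p ∈ N.primeFactors, Δ.factorization p : ℕ) : ℝ) < (N : ℝ) ^ (8 / 3 + ε : ℝ) := by
  have hN0 : N ≠ 0 := hsq.ne_zero
  have hN1 : (1 : ℝ) ≤ N := by exact_mod_cast Nat.pos_of_ne_zero hN0
  have h1N : 1 < N := by
    refine Nat.one_lt_iff_ne_zero_and_ne_one.2 ⟨hN0, fun h1 => ?_⟩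
    rw [h1, Nat.primeFactors_one, card_empty] at h0
    exact lt_irrefl 0 h0
  have h := H N h1N dvd_rfl heven
    (by rw [Nat.div_self (Nat.pos_of_ne_zero hN0)]; exact Nat.not_prime_one)
  rw [Nat.div_self (Nat.pos_of_ne_zero hN0), Nat.cast_one, mul_one] at h
  exact h.trans_le (Real.rpow_le_rpow_of_exponent_le hN1 (by linarith))

/-- **Theorem 16.5, second part, in the vendored "at least `3 + 11/ε`" form, at every `ε` the paper's
results reach**: all `ε > 0` except `ε = 11/m` with `m` even `≥ 10` (hypothesis `hgap`).  Inputs: the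
named fact `pastenShimura2024_thm_1_12` (`h112`, small conductors), Theorem 16.1 of loc. cit. in the
semi-stable case with `S = ∅` as an inline hypothesis `h161` (for `N ≥ N_0(ε)` and every divisor
`1 < D ∣ N` with an even number of prime factors, `∏_{p ∣ D} v_p(Δ_E) < N^{11/3+ε}`; the printed "all
but finitely many `E`" implies this threshold form), and Theorem 16.4 (i) inline (`h164`).  Proof: off
the boundary the strict theorem `pastenShimura2024_thm_16_5_manyPrimes_strict_of_thm_16_4`; at the
boundary `n = 3 + 11/ε`: `n` even by `prod_lt_rpow_of_thm_16_4_at_even`, `n ∈ {5, 7, 9, 11}` by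
`prod_lt_rpow_of_thm_16_1_at` with `ε' = 1/132` (`n(11/3 + 1/132) ≤ (n-1)(8/3 + 11/(n-3))`), conductors
below the thresholds by Theorem 1.12 with exponent `13/2`.  NOT covered (by anything in print):
`ε = 11/m`, `m` even `≥ 10`, curves with exactly `m + 3` bad primes — see the module docstring.
[cite: PastenShimura2024, Theorems 16.1, 16.4 (i), 16.5 and proof of Corollary 16.2 (arXiv numbering)] -/
theorem pastenShimura2024_thm_16_5_manyPrimes_of_thm_1_12_of_thm_16_1_of_thm_16_4
    (h112 : pastenShimura2024_thm_1_12)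
    (h161 : ∀ ε : ℝ, 0 < ε → ∃ N₀ : ℕ, ∀ (W : WeierstrassCurve ℚ) [W.IsElliptic],
      Squarefree (W.conductorNorm ℤ) → N₀ ≤ W.conductorNorm ℤ →
        ∀ D : ℕ, 1 < D → D ∣ W.conductorNorm ℤ → Even D.primeFactors.card →
          ((∏ p ∈ D.primeFactors, (W.minimalDiscriminantNorm ℤ).factorization p : ℕ) : ℝ)
            < (W.conductorNorm ℤ : ℝ) ^ (11 / 3 + ε : ℝ))
    (h164 : ∀ ε : ℝ, 0 < ε → ∃ N₀ : ℕ, ∀ (W : WeierstrassCurve ℚ) [W.IsElliptic],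
      Squarefree (W.conductorNorm ℤ) → N₀ ≤ W.conductorNorm ℤ →
        ∀ D : ℕ, 1 < D → D ∣ W.conductorNorm ℤ → Even D.primeFactors.card →
          ¬ (W.conductorNorm ℤ / D).Prime →
            ((∏ p ∈ D.primeFactors, (W.minimalDiscriminantNorm ℤ).factorization p : ℕ) : ℝ)
              < (W.conductorNorm ℤ : ℝ) ^ (8 / 3 + ε : ℝ) * ((W.conductorNorm ℤ / D : ℕ) : ℝ))
    {ε : ℝ} (hε : 0 < ε) (hgap : ∀ m : ℕ, (11 : ℝ) / ε = m → Even m → m ≤ 8) :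
    ∃ K : ℝ, 0 < K ∧ ∀ (W : WeierstrassCurve ℚ) [W.IsElliptic],
      Squarefree (W.conductorNorm ℤ) →
        (3 : ℝ) + 11 / ε ≤ ((W.conductorNorm ℤ).primeFactors.card : ℝ) →
          ((∏ p ∈ (W.conductorNorm ℤ).primeFactors,
              (W.minimalDiscriminantNorm ℤ).factorization p : ℕ) : ℝ)
            < K * (W.conductorNorm ℤ : ℝ) ^ (8 / 3 + ε : ℝ) := by
  obtain ⟨Ks, hKs, hstrict⟩ :=
    pastenShimura2024_thm_16_5_manyPrimes_strict_of_thm_16_4 h112 h164 ε hε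
  obtain ⟨N₄, hN₄⟩ := h164 ε hε
  obtain ⟨N₁, hN₁⟩ := h161 (1 / 132) (by norm_num)
  obtain ⟨K₁, hK₁pos, hK₁⟩ := h112 1 one_pos
  have hK₂pos : (0 : ℝ) < max (K₁ * ((max N₄ N₁ : ℕ) : ℝ) ^ (11 / 2 + 1 : ℝ)) 1 :=
    lt_max_of_lt_right one_pos
  have hKpos : (0 : ℝ) < max Ks (max (K₁ * ((max N₄ N₁ : ℕ) : ℝ) ^ (11 / 2 + 1 : ℝ)) 1) :=
    lt_max_of_lt_left hKs
  refine ⟨max Ks (max (K₁ * ((max N₄ N₁ : ℕ) : ℝ) ^ (11 / 2 + 1 : ℝ)) 1), hKpos,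
    fun W _ hsq hn => ?_⟩
  rcases hn.lt_or_eq with hlt | heq
  · -- more than `3 + 11/ε` bad places: the strict theorem
    exact (hstrict W hsq hlt).trans_le
      (mul_le_mul_of_nonneg_right (le_max_left _ _) (Real.rpow_nonneg (Nat.cast_nonneg _) _))
  · -- exactly `3 + 11/ε` bad places
    obtain ⟨N, hN⟩ : ∃ N : ℕ, W.conductorNorm ℤ = N := ⟨_, rfl⟩
    obtain ⟨Δ, hΔ⟩ : ∃ Δ : ℕ, W.minimalDiscriminantNorm ℤ = Δ := ⟨_, rfl⟩
    have H164 : N₄ ≤ N → ∀ D : ℕ, 1 < D → D ∣ N → Even D.primeFactors.card → ¬ (N / D).Prime →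
        ((∏ p ∈ D.primeFactors, Δ.factorization p : ℕ) : ℝ) <
          (N : ℝ) ^ (8 / 3 + ε : ℝ) * ((N / D : ℕ) : ℝ) := by
      have h := hN₄ W hsq; rwa [hN, hΔ] at h
    have H161 : N₁ ≤ N → ∀ D : ℕ, 1 < D → D ∣ N → Even D.primeFactors.card →
        ((∏ p ∈ D.primeFactors, Δ.factorization p : ℕ) : ℝ) < (N : ℝ) ^ (11 / 3 + 1 / 132 : ℝ) := by
      have h := hN₁ W hsq; rwa [hN, hΔ] at h
    have H112 : ((∏ p ∈ N.primeFactors, Δ.factorization p : ℕ) : ℝ) <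
        K₁ * (N : ℝ) ^ (11 / 2 + 1 : ℝ) := by
      have h := hK₁ W hsq; rwa [hN, hΔ] at h
    rw [hN] at hsq heq
    rw [hN, hΔ]
    have hN0 : N ≠ 0 := hsq.ne_zero
    have hNpos : (0 : ℝ) < N := by exact_mod_cast Nat.pos_of_ne_zero hN0
    have hrpow_pos : 0 < (N : ℝ) ^ (8 / 3 + ε : ℝ) := Real.rpow_pos_of_pos hNpos _
    have hrpow_one : 1 ≤ (N : ℝ) ^ (8 / 3 + ε : ℝ) :=
      Real.one_le_rpow (by exact_mod_cast Nat.pos_of_ne_zero hN0) (by positivity)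
    by_cases hsmall : N < max N₄ N₁
    · -- small conductor: Theorem 1.12 with exponent `13/2`
      calc ((∏ p ∈ N.primeFactors, Δ.factorization p : ℕ) : ℝ)
          < K₁ * (N : ℝ) ^ (11 / 2 + 1 : ℝ) := H112
        _ ≤ K₁ * ((max N₄ N₁ : ℕ) : ℝ) ^ (11 / 2 + 1 : ℝ) := mul_le_mul_of_nonneg_left
            (Real.rpow_le_rpow hNpos.le (by exact_mod_cast hsmall.le) (by norm_num)) hK₁pos.le
        _ ≤ max (K₁ * ((max N₄ N₁ : ℕ) : ℝ) ^ (11 / 2 + 1 : ℝ)) 1 := le_max_left _ _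
        _ ≤ max Ks (max (K₁ * ((max N₄ N₁ : ℕ) : ℝ) ^ (11 / 2 + 1 : ℝ)) 1) := le_max_right _ _
        _ ≤ _ := le_mul_of_one_le_right hKpos.le hrpow_one
    · rw [not_lt] at hsmall
      have h4 : N₄ ≤ N := le_trans (le_max_left _ _) hsmall
      have h1 : N₁ ≤ N := le_trans (le_max_right _ _) hsmall
      obtain ⟨n, hn_def⟩ : ∃ n : ℕ, N.primeFactors.card = n := ⟨_, rfl⟩
      rw [hn_def] at heq
      have h11pos : (0 : ℝ) < 11 / ε := by positivity
      have hn3 : 3 < n := by exact_mod_cast (show (3 : ℝ) < n by linarith)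
      have h11 : (11 : ℝ) = ((n : ℝ) - 3) * ε := (div_eq_iff hε.ne').1 (by linarith)
      have hmain : ((∏ p ∈ N.primeFactors, Δ.factorization p : ℕ) : ℝ) < (N : ℝ) ^ (8 / 3 + ε : ℝ) := by
        rcases Nat.even_or_odd n with hev | hod
        · -- `n` even: `D = N`, `M = 1`
          exact prod_lt_rpow_of_thm_16_4_at_even le_rfl hsq (by omega) (by rw [hn_def]; exact hev)
            (H164 h4)
        · -- `n` odd: `m = n - 3` is even, so `m ≤ 8` by `hgap`, i.e. `n ∈ {5, 7, 9, 11}`: Theorem 16.1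
          have hm : (11 : ℝ) / ε = ((n - 3 : ℕ) : ℝ) := by push_cast [hn3.le]; linarith
          have hmeven : Even (n - 3) := by obtain ⟨k, hk⟩ := hod; exact ⟨k - 1, by omega⟩
          have hm8 := hgap (n - 3) hm hmeven
          have hcases : n = 5 ∨ n = 7 ∨ n = 9 ∨ n = 11 := by obtain ⟨k, hk⟩ := hod; omega
          refine prod_lt_rpow_of_thm_16_1_at hsq (by rw [hn_def]; exact hod) (by omega) ?_ (H161 h1)
          rw [hn_def]
          rcases hcases with rfl | rfl | rfl | rfl <;> push_cast at h11 ⊢ <;> nlinarith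
      calc ((∏ p ∈ N.primeFactors, Δ.factorization p : ℕ) : ℝ)
          < (N : ℝ) ^ (8 / 3 + ε : ℝ) := hmain
        _ ≤ _ := le_mul_of_one_le_left hrpow_pos.le
            (le_trans (le_max_right _ 1) (le_max_right Ks _))

end Literature.NumberTheory.DiophantineGeometry

end
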